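import Mathlib.CategoryTheory.SingleObj
import Mathlib.Algebra.Group.PUnit
import Literature.AlgebraicGeometry.Frobenioids.DivisorMonoidCategoryTheoreticitySchemaNegative
import HarnessLib

/-!
# Frobenioids I, §4: the universal closures of the INTERFACE-typed Prop. 4.4 (i), (ii) and
# Prop. 4.8 (i) (FACT-LIST F-1044 / F-1045 / F-1048) are false; the instance forms at THE
# birationalization hold

Mochizuki, *The geometry of Frobenioids I: the general theory*, Kyushu J. Math. **62** (2008)
293–400, §4, Proposition 4.4 (i), (ii) p. 83 ("(i) … hence a category `C^birat` … (ii) … the functor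
`C → C^birat` is faithful … injection `O^▷(A)^gp ↪ O^×(A^birat)`") and Proposition 4.8 (i) p. 88 ("If
`C` is of isotropic type, then so is `C^birat`") [cite: MochizukiFrdI2008, Prop. 4.4 (ii) p.83]
[cite: MochizukiFrdI2008, Prop. 4.8 (i) p.88].

PROOF-ONLY companion (cell abc-iut, block F fact-proving wave, seat abc-iut-f-025; FACT-LIST rows
**F-1044** `PreFrobenioidData.Prop44i`, **F-1045** `PreFrobenioidData.Prop44ii`, **F-1048**
`PreFrobenioidData.Prop48i` — all three labelled «universal-closure REFUTED / schema» by the R7 kernel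
TYPE-audit of abc-iut-w5-d199 WITHOUT a kernel object for the refutation) of
`DivisorMonoidCategoryTheoreticityDefs.lean` (seat abc-iut-L1-t3), twin of abc-iut-f-035's
`DivisorMonoidCategoryTheoreticitySchemaNegative.lean` (rows F-1046 / F-1047 / F-1049), whose junk
birationalization datum `PreFrobenioidData.exists_junk_biratData` is re-used BY NAME and whose
construction is varied twice below.  The three items are typed as predicates on a data-only
birationalization datum `B : S.BiratData` ("never quantify universally over it", says the interface's own
docstring); this file records, kernel checked, that their universal closures (universe `0`) are FALSE:

* `not_forall_prop44i` — f-035's junk datum (`C = C^birat = SingleObj ℕ⁺` over `SingleObj PUnit`,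
  `deg_Fr(n) = n` on `C`, all degrees reset to `1` on `C^birat`) violates the degree clause of (i) at
  `n = 2` (its `1`-commutativity clause holds for EVERY datum: it is the field `overBase`);
* `exists_junk_biratData_not_isotropic` / `not_forall_prop48i` — the same datum: `C` is of isotropic
  type (its only pre-step is the identity) while in `C^birat` the arrow `2 : ⋆ → ⋆` is an isometric
  pre-step that is not invertible in `ℕ⁺`, so `C^birat` is NOT of isotropic type;
* `exists_junk_biratData_not_prop44ii` / `not_forall_prop44ii` — the variant with ALL degrees `1`
  already on `C` and `B` the identity datum: `2 ∈ O^▷(⋆)` (base-identity, linear) is sent by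
  `C → C^birat = 𝟭` to a non-isomorphism, violating the third clause of (ii).

INSTANCE forms (what consumers bind) are theorems of the tree at THE birationalization
`PreFrobenioid.biratData hF _` of every Frobenioid: `PreFrobenioid.prop44i_holds_of_isFrobenioid`,
`PreFrobenioid.prop44ii_holds_of_isFrobenioid` (`BirationalizationProp44.lean`),
`PreFrobenioid.prop48i_biratData` (`DivisorMonoidBirationalProp48.lean`).  So each row is admissible ONLY
at named instances (R5).  Refuted-closure ≠ refuted-paper; no definitions; no statement of the paper is
strengthened; nothing here bears on [IUTchIII] Cor. 3.12.
-/

namespace Literature.AlgebraicGeometry.Frobenioids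

open CategoryTheory

namespace PreFrobenioidData

/-! ### F-1044: the degree clause of Prop. 4.4 (i) fails at f-035's junk datum -/

/-- **The universal closure of [FrdI] Prop. 4.4 (i) AS TYPED over the interface (`Prop44i B`,
`B : S.BiratData` arbitrary) is FALSE** (universe `0`): for abc-iut-f-035's junk datum
(`exists_junk_biratData`) the functor `C → C^birat` does not preserve the Frobenius degree `2`, contra the
second clause of `Prop44i`.  The instance form at THE birationalization of every Frobenioid is
`PreFrobenioid.prop44i_holds_of_isFrobenioid`. [cite: MochizukiFrdI2008, Prop. 4.4 (i) p.83] -/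
theorem not_forall_prop44i :
    ¬ ∀ (C : Type) [Category.{0} C] (D : Type) [Category.{0} D] (S : PreFrobenioidData.{0} C D)
        (B : BiratData.{0, 0, 0, 0, 0, 0} S), Prop44i B := by
  intro h
  obtain ⟨S, B, -, -, -, hdeg⟩ := exists_junk_biratData
  exact hdeg fun A A' φ hφ => ((h _ _ S B).2 φ).trans hφ

/-! ### F-1048: a datum over operations of isotropic type whose `C^birat` is not of isotropic type -/

/-- **A junk `BiratData` against Prop. 4.8 (i)** (the datum of abc-iut-f-035's `exists_junk_biratData`,
rebuilt to expose isotropy): on `C := SingleObj ℕ⁺` over `D := SingleObj PUnit` with zero divisor monoid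
and `deg_Fr(n) := n`, the only pre-step is `1`, so `C` is of ISOTROPIC type; the datum `C^birat := C`,
`C → C^birat := 𝟭`, all degrees reset to `1`, makes EVERY arrow of `C^birat` an isometric pre-step, and
`2 : ⋆ → ⋆` is not invertible — `C^birat` is not of isotropic type. [cite: MochizukiFrdI2008, Prop. 4.8 (i) p.88] -/
theorem exists_junk_biratData_not_isotropic :
    ∃ (S : PreFrobenioidData.{0} (SingleObj ℕ+) (SingleObj PUnit.{1}))
      (B : BiratData.{0, 0, 0, 0, 0, 0} S), S.IsOfIsotropicType ∧ ¬ B.ops.IsOfIsotropicType := by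
  let bs : SingleObj ℕ+ ⥤ SingleObj PUnit.{1} := MonoidHom.toFunctor (1 : ℕ+ →* PUnit)
  let S : PreFrobenioidData.{0} (SingleObj ℕ+) (SingleObj PUnit.{1}) :=
    { base := bs
      Mon := fun _ => PUnit
      pull := fun _ => MonoidHom.id _
      pull_id := fun _ _ => rfl
      pull_comp := fun _ _ _ => rfl
      div := fun _ => 1
      degFr := fun φ => (φ : ℕ+)
      div_id := fun _ => rfl
      div_comp := fun _ _ => rfl
      degFr_id := fun _ => rfl
      degFr_comp := fun ψ φ => mul_comm (show ℕ+ from φ) (show ℕ+ from ψ) }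
  let S₁ : PreFrobenioidData.{0} (SingleObj ℕ+) (SingleObj PUnit.{1}) :=
    { base := bs
      Mon := fun _ => PUnit
      pull := fun _ => MonoidHom.id _
      pull_id := fun _ _ => rfl
      pull_comp := fun _ _ _ => rfl
      div := fun _ => 1
      degFr := fun _ => 1
      div_id := fun _ => rfl
      div_comp := fun _ _ => rfl
      degFr_id := fun _ => rfl
      degFr_comp := fun _ _ => (mul_one _).symm }
  let B : BiratData.{0, 0, 0, 0, 0, 0} S :=
    { Birat := SingleObj ℕ+
      toBirat := 𝟭 _
      obj_surjective := fun X => ⟨X, rfl⟩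
      ops := S₁
      ops_mon_eq_one := fun _ _ => rfl
      overBase := bs.leftUnitor
      phiBirat := fun _ => ⊤
      divBirat := fun _ => 1
      divBirat_mem := fun _ _ => Subgroup.mem_top _ }
  -- `2 : ⋆ → ⋆` is not invertible in `SingleObj ℕ⁺`
  have htwo : ¬ IsIso (show SingleObj.star ℕ+ ⟶ SingleObj.star ℕ+ from (2 : ℕ+)) := by
    intro hι
    have e := IsIso.inv_hom_id (show SingleObj.star ℕ+ ⟶ SingleObj.star ℕ+ from (2 : ℕ+))
    rw [SingleObj.comp_as_mul, SingleObj.id_as_one] at e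
    have e' := congrArg PNat.val e
    rw [PNat.mul_coe] at e'
    exact absurd (Nat.eq_one_of_mul_eq_one_right e') (by decide)
  -- pre-steps of `S` are the identity `1 ∈ ℕ⁺`, hence isomorphisms
  have hiso : ∀ {X Y : SingleObj ℕ+} (ψ : X ⟶ Y), S.IsPreStep ψ → IsIso ψ := by
    intro X Y ψ h
    have e : (show ℕ+ from ψ) = 1 := h.1
    refine ⟨⟨(show Y ⟶ X from (1 : ℕ+)), ?_, ?_⟩⟩
    · show (1 : ℕ+) * (show ℕ+ from ψ) = 1
      rw [e, mul_one]
    · show (show ℕ+ from ψ) * 1 = 1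
      rw [e, mul_one]
  refine ⟨S, B, ⟨fun A => fun B' φ hφ => hiso φ hφ.1⟩, fun h => htwo ?_⟩
  -- in `C^birat` every arrow is an isometric pre-step
  exact h.obj (SingleObj.star ℕ+) (show SingleObj.star ℕ+ ⟶ SingleObj.star ℕ+ from (2 : ℕ+))
    ⟨⟨rfl, (inferInstance : IsIso (bs.map _))⟩, rfl⟩

/-- **The universal closure of [FrdI] Prop. 4.8 (i) AS TYPED over the interface (`Prop48i S B`) is
FALSE** (universe `0`), by `exists_junk_biratData_not_isotropic`.  The printed statement is the instance
at THE birationalization, PROVED for every Frobenioid (`PreFrobenioid.prop48i_biratData`).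
[cite: MochizukiFrdI2008, Prop. 4.8 (i) p.88] -/
theorem not_forall_prop48i :
    ¬ ∀ (C : Type) [Category.{0} C] (D : Type) [Category.{0} D] (S : PreFrobenioidData.{0} C D)
        (B : BiratData.{0, 0, 0, 0, 0, 0} S), Prop48i S B := by
  intro h
  obtain ⟨S, B, hiso, hnot⟩ := exists_junk_biratData_not_isotropic
  exact hnot (h _ _ S B hiso)

/-! ### F-1045: a datum whose `C → C^birat` inverts no element of `O^▷(⋆)` except the identity -/

/-- **A junk `BiratData` against Prop. 4.4 (ii)**: on `C := SingleObj ℕ⁺` over `D := SingleObj PUnit`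
take the operations with zero divisor monoid and ALL Frobenius degrees `1`, and the IDENTITY datum
(`C^birat := C`, `C → C^birat := 𝟭`, the same operations).  Then `2 ∈ O^▷(⋆)` (a base-identity linear
endomorphism) is sent to `2`, which is not an isomorphism of `C^birat` — contra the third clause of
`Prop44ii` ("`O^▷(A)^gp ↪ O^×(A^birat)`"). [cite: MochizukiFrdI2008, Prop. 4.4 (ii) p.83] -/
theorem exists_junk_biratData_not_prop44ii :
    ∃ (S : PreFrobenioidData.{0} (SingleObj ℕ+) (SingleObj PUnit.{1}))
      (B : BiratData.{0, 0, 0, 0, 0, 0} S), ¬ Prop44ii B := by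
  let bs : SingleObj ℕ+ ⥤ SingleObj PUnit.{1} := MonoidHom.toFunctor (1 : ℕ+ →* PUnit)
  let S₁ : PreFrobenioidData.{0} (SingleObj ℕ+) (SingleObj PUnit.{1}) :=
    { base := bs
      Mon := fun _ => PUnit
      pull := fun _ => MonoidHom.id _
      pull_id := fun _ _ => rfl
      pull_comp := fun _ _ _ => rfl
      div := fun _ => 1
      degFr := fun _ => 1
      div_id := fun _ => rfl
      div_comp := fun _ _ => rfl
      degFr_id := fun _ => rfl
      degFr_comp := fun _ _ => (mul_one _).symm }
  let B : BiratData.{0, 0, 0, 0, 0, 0} S₁ :=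
    { Birat := SingleObj ℕ+
      toBirat := 𝟭 _
      obj_surjective := fun X => ⟨X, rfl⟩
      ops := S₁
      ops_mon_eq_one := fun _ _ => rfl
      overBase := bs.leftUnitor
      phiBirat := fun _ => ⊤
      divBirat := fun _ => 1
      divBirat_mem := fun _ _ => Subgroup.mem_top _ }
  -- `2 : ⋆ → ⋆` is not invertible in `SingleObj ℕ⁺`
  have htwo : ¬ IsIso (show SingleObj.star ℕ+ ⟶ SingleObj.star ℕ+ from (2 : ℕ+)) := by
    intro hι
    have e := IsIso.inv_hom_id (show SingleObj.star ℕ+ ⟶ SingleObj.star ℕ+ from (2 : ℕ+))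
    rw [SingleObj.comp_as_mul, SingleObj.id_as_one] at e
    have e' := congrArg PNat.val e
    rw [PNat.mul_coe] at e'
    exact absurd (Nat.eq_one_of_mul_eq_one_right e') (by decide)
  refine ⟨S₁, B, fun h => htwo ?_⟩
  -- `2 ∈ O^▷(⋆)`: base-identity (the base has one morphism) and linear (all degrees are `1`)
  have hmem : (show End (SingleObj.star ℕ+) from (2 : ℕ+)) ∈ S₁.endSubmonoid (SingleObj.star ℕ+) :=
    ⟨rfl, rfl⟩
  exact (h.2.2 (SingleObj.star ℕ+) _ hmem).1

/-- **The universal closure of [FrdI] Prop. 4.4 (ii) AS TYPED over the interface (`Prop44ii B`) is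
FALSE** (universe `0`), by `exists_junk_biratData_not_prop44ii`.  The printed statement is the instance
at THE birationalization, PROVED for every Frobenioid (`PreFrobenioid.prop44ii_holds_of_isFrobenioid`; in
the 2024 form: author's Comments item (29)). [cite: MochizukiFrdI2008, Prop. 4.4 (ii) p.83] -/
theorem not_forall_prop44ii :
    ¬ ∀ (C : Type) [Category.{0} C] (D : Type) [Category.{0} D] (S : PreFrobenioidData.{0} C D)
        (B : BiratData.{0, 0, 0, 0, 0, 0} S), Prop44ii B := by
  intro h
  obtain ⟨S, B, hnot⟩ := exists_junk_biratData_not_prop44ii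
  exact hnot (h _ _ S B)

end PreFrobenioidData

end Literature.AlgebraicGeometry.Frobenioids
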